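/-
COR-CM (cell pub-hodgecm2, stage 2 of the Hodge ladder) — count-neutral KERNEL COMBINATORICS «spectator doubling G = H × ⟨x⟩ (x a CENTRAL involution
outside the index-two subgroup H ∋ c), part V: the two-sided estimate packaged — β(G) − 2 + d₂(H/𝒦_H) ≤ μ(G, c) ≤ μ(H, c) + #{far} + (|H|/2)·2^{|H|/2 − 2}»
(seat prover-pub-hodgecm2-b23-g47-0, binder prover b23, gen 47; claim «SPECTATOR DOUBLING», HOME/INBOX.md l.21993).  Theorems only, on top of parts II–IV
(`Census/SpectatorClosing`, `Census/SpectatorFibre`, `Census/SpectatorBlocks`) BY NAME; no `decide`, no certificate, no named fact, no `sorry`;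
`Interfaces.lean` (C1), every E term, B01, `Transposition/*`, `PortJoin/*`, `D2Bridge/*` untouched.
HONEST FRAMING: `HC_CM` is NOT proved, here or anywhere in the tree; nothing here is a period, a count of record or a headline.
T5: n/a-class (hypothesis binders: `c * c = 1`, `c ≠ 1`, `c` central, `c ∈ H`, `H.index = 2`, `x ∉ H`, `x * x = 1`, `x` central, `|H| ≠ 2`);
checker: self.
-/
import Summits.HodgeConjecture.CorCM.Census.SpectatorClosing
import Summits.HodgeConjecture.CorCM.Census.SpectatorFibre
import Summits.HodgeConjecture.CorCM.Census.SpectatorBlocks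

/-!
# Spectator doubling `G = H × ⟨x⟩`, V: the two-sided estimate for the census number `μ(H × C₂, c)`

THE SETTING of parts I–IV: `c ≠ 1` a central involution of the finite group `G`, `H ∋ c` of index two, `x ∉ H` CENTRAL with `x · x = 1`
(`G = H × ⟨x⟩`; field side `F = F₀ · k` with `k` a disjoint real quadratic field).  Write `n_H = |H|/2` (the number of places of `H`),
`#far` = the number of blocks of `(G, c)` of distance `≥ 2`, `#nbr` = the number of blocks of distance `1` (`#nbr · 4 = 2^{n_H}`, part IV).
The census set `{ |S| : S ⊆ faces, ℤ⟨pairs⟩ + ℤ[G]·S ⊇ hodgeSpan }` has least element `μ(G, c)`.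

* **FLOOR** (part IIIʼs `mem_lowerBounds_spectator`): `β(G, c) + d₂(H/𝒦(H, c)) − 2` is a lower bound of the census set of `(G, c)`.
* **CEILING** (`ceiling_spectator`, parts II + IV): if `(H, c)` has a generating face family of `m` members then `(G, c)` has one of at most
  `m + #far + n_H · #nbr` members; with `#nbr · 4 = 2^{n_H}` (`|H| ≠ 2`) and `β(G, c) = β(H, c) + #nbr + #far`.
* **THE TWO-SIDED ESTIMATE** (`two_sided_spectator`): if `μ(H, c) = m` (an `IsLeast` witness) then
  `β(G,c) + d₂(H/𝒦_H) − 2 ≤ μ ≤ m + #far + n_H · #nbr` for the least element `μ` of the census set of `(G, c)`.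
  When `m = φ₂(H, c) = β(H, c) − 2 + d₂(H/𝒦_H)` (`n_H` even) the two bounds differ by `(n_H − 1) · #nbr = (n_H − 1) · 2^{n_H − 2}`;
  numerically (design note `HOME/pub-hodgecm2-b23/SPECTATOR.md`, twelve rows `n_H ≤ 6` and gen 46ʼs eight rows `n_H = 8`) the floor is the truth.

## References
* [Pohlmann1968] H. Pohlmann, Algebraic cycles on abelian varieties of complex multiplication type, Ann. of Math. 88 (1968), Thm 1.
* [Milne1999] J. S. Milne, Lefschetz motives and the Tate conjecture, Compositio Math. 117 (1999), Prop. 2.1, p. 54.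
-/

namespace Summit.HodgeConjecture.CorCM.Census.Spectator

open Finset
open Summit.HodgeConjecture.CorCM.Prior.AllgGroup.RfwfAllgGroup
open Summit.HodgeConjecture.CorCM.Census.BlockParity
open Summit.HodgeConjecture.CorCM.Census.Coinvariant
open Summit.HodgeConjecture.CorCM.Census.ComplementFaces
open Summit.HodgeConjecture.CorCM.Census.TypeStabiliser
open Summit.HodgeConjecture.CorCM.Census.IndexTwo
open Summit.HodgeConjecture.CorCM.Census.IndexTwoDescent

noncomputable section

variable {G : Type*} [Group G] [Fintype G] [DecidableEq G] {c : G}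
variable {H : Subgroup G} [DecidablePred (· ∈ H)]

/-- **CEILING**: from a generating face family of `(H, c)` with `m` members, a generating face family of `(G, c)` with at most
`m + #far + (|H|/2) · #nbr` members, where `#nbr · 4 = 2^{|H|/2}` and `β(G, c) = β(H, c) + #nbr + #far`. [folklore] -/
theorem ceiling_spectator (hcH : c ∈ H) (hc2 : c * c = 1) (hc1 : c ≠ 1) (hcen : ∀ g : G, g * c = c * g)
    (hH : H.index = 2) {x : G} (hx : x ∉ H) (hxx : x * x = 1) (hxc : ∀ g : G, g * x = x * g) (hH2 : Fintype.card H ≠ 2)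
    (S : Finset (CMF H ⟨c, hcH⟩ →₀ ℤ)) (hSf : (S : Set (CMF H ⟨c, hcH⟩ →₀ ℤ)) ⊆ gfaceSet H ⟨c, hcH⟩ (csub_mul_csub hcH hc2))
    (hS : hodgeSpan (⟨c, hcH⟩ : H) (csub_mul_csub hcH hc2) ≤
      Submodule.span ℤ (pairSet (⟨c, hcH⟩ : H)) ⊔ Submodule.span ℤ (translates (⟨c, hcH⟩ : H) S)) :
    (∃ 𝒮 : Finset (CMF G c →₀ ℤ), (𝒮 : Set (CMF G c →₀ ℤ)) ⊆ gfaceSet G c hc2 ∧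
      𝒮.card ≤ S.card +
        (Finset.univ.filter fun b : Block c => 2 ≤ wt (⟨c, hcH⟩ : H) (res₁ hcH hcen x b.out) (res₀ hcH b.out)).card +
        (Fintype.card H / 2) *
          (Finset.univ.filter fun b : Block c => wt (⟨c, hcH⟩ : H) (res₁ hcH hcen x b.out) (res₀ hcH b.out) = 1).card ∧
      hodgeSpan c hc2 ≤ Submodule.span ℤ (pairSet c) ⊔ Submodule.span ℤ (translates c 𝒮)) ∧
    (Finset.univ.filter fun b : Block c => wt (⟨c, hcH⟩ : H) (res₁ hcH hcen x b.out) (res₀ hcH b.out) = 1).card * 4 =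
      2 ^ (Fintype.card H / 2) ∧
    Fintype.card (Block c) = Fintype.card (Block (⟨c, hcH⟩ : H)) +
      (Finset.univ.filter fun b : Block c => wt (⟨c, hcH⟩ : H) (res₁ hcH hcen x b.out) (res₀ hcH b.out) = 1).card +
      (Finset.univ.filter fun b : Block c => 2 ≤ wt (⟨c, hcH⟩ : H) (res₁ hcH hcen x b.out) (res₀ hcH b.out)).card := by
  refine ⟨exists_generating_family_spectator_card hcH hc2 hc1 hcen hH hx hxx hxc S hSf hS, ?_,
    card_block_spectator hcH hcen hc2 hH hx hxx hxc⟩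
  rw [← card_nbr_blocks_mul_four hcH hcen hc2 hc1 hH hx hxx hxc hH2, Fintype.card_subtype]

/-- **THE TWO-SIDED ESTIMATE FOR THE SPECTATOR DOUBLING.**  If `m` is the census number of `(H, c)` (the least cardinality of a face family whose
base changes generate `hodgeSpan (H, c)` modulo pairs), then the census number `μ` of `(G, c) = (H × ⟨x⟩, c)` satisfies
`β(G, c) + d₂(H/𝒦(H, c)) − 2 ≤ μ ≤ m + #{far blocks} + (|H|/2) · #{neighbour blocks}`. [folklore] -/
theorem two_sided_spectator (hcH : c ∈ H) (hc2 : c * c = 1) (hc1 : c ≠ 1) (hcen : ∀ g : G, g * c = c * g)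
    (hH : H.index = 2) {x : G} (hx : x ∉ H) (hxx : x * x = 1) (hxc : ∀ g : G, g * x = x * g) {m μ : ℕ}
    (hm : IsLeast {k : ℕ | ∃ S : Finset (CMF H ⟨c, hcH⟩ →₀ ℤ), (↑S ⊆ gfaceSet H ⟨c, hcH⟩ (csub_mul_csub hcH hc2)) ∧ S.card = k ∧
      hodgeSpan (⟨c, hcH⟩ : H) (csub_mul_csub hcH hc2) ≤
        Submodule.span ℤ (pairSet (⟨c, hcH⟩ : H)) ⊔ Submodule.span ℤ (translates (⟨c, hcH⟩ : H) S)} m)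
    (hμ : IsLeast {k : ℕ | ∃ S : Finset (CMF G c →₀ ℤ), (↑S ⊆ gfaceSet G c hc2) ∧ S.card = k ∧
      hodgeSpan c hc2 ≤ Submodule.span ℤ (pairSet c) ⊔ Submodule.span ℤ (translates c S)} μ) :
    Fintype.card (Block c) + indexTwoRank (stabGen (⟨c, hcH⟩ : H)) - 2 ≤ μ ∧
      μ ≤ m + (Finset.univ.filter fun b : Block c => 2 ≤ wt (⟨c, hcH⟩ : H) (res₁ hcH hcen x b.out) (res₀ hcH b.out)).card +
        (Fintype.card H / 2) *
          (Finset.univ.filter fun b : Block c => wt (⟨c, hcH⟩ : H) (res₁ hcH hcen x b.out) (res₀ hcH b.out) = 1).card := by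
  refine ⟨mem_lowerBounds_spectator hcH hc2 hc1 hcen hH hx hxx hxc hμ.1, ?_⟩
  obtain ⟨S, hSf, hScard, hS⟩ := hm.1
  obtain ⟨𝒮, h𝒮f, hcard, hgen⟩ := exists_generating_family_spectator_card hcH hc2 hc1 hcen hH hx hxx hxc S hSf hS
  rw [hScard] at hcard
  exact le_trans (hμ.2 ⟨𝒮, h𝒮f, rfl, hgen⟩) hcard

/-- The same with the floor of `(H, c)` inserted: if `(H, c)` attains ITS floor (`m + 2 = β(H, c) + d₂(H/𝒦_H)`, the law `μ = φ₂` for `H` with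
`|H|/2` even), the census number of the doubling lies in an interval of length `(|H|/2 − 1) · #{neighbour blocks}` above its floor:
`μ + 2 ≤ β(G) + d₂ + (|H|/2 − 1)·#nbr`, `β(G) + d₂ ≤ μ + 2`. [folklore] -/
theorem two_sided_spectator_of_law (hcH : c ∈ H) (hc2 : c * c = 1) (hc1 : c ≠ 1) (hcen : ∀ g : G, g * c = c * g)
    (hH : H.index = 2) {x : G} (hx : x ∉ H) (hxx : x * x = 1) (hxc : ∀ g : G, g * x = x * g) {m μ : ℕ}
    (hm : IsLeast {k : ℕ | ∃ S : Finset (CMF H ⟨c, hcH⟩ →₀ ℤ), (↑S ⊆ gfaceSet H ⟨c, hcH⟩ (csub_mul_csub hcH hc2)) ∧ S.card = k ∧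
      hodgeSpan (⟨c, hcH⟩ : H) (csub_mul_csub hcH hc2) ≤
        Submodule.span ℤ (pairSet (⟨c, hcH⟩ : H)) ⊔ Submodule.span ℤ (translates (⟨c, hcH⟩ : H) S)} m)
    (hlaw : m + 2 = Fintype.card (Block (⟨c, hcH⟩ : H)) + indexTwoRank (stabGen (⟨c, hcH⟩ : H)))
    (hμ : IsLeast {k : ℕ | ∃ S : Finset (CMF G c →₀ ℤ), (↑S ⊆ gfaceSet G c hc2) ∧ S.card = k ∧
      hodgeSpan c hc2 ≤ Submodule.span ℤ (pairSet c) ⊔ Submodule.span ℤ (translates c S)} μ) :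
    Fintype.card (Block c) + indexTwoRank (stabGen (⟨c, hcH⟩ : H)) ≤ μ + 2 ∧
      μ + 2 ≤ Fintype.card (Block c) + indexTwoRank (stabGen (⟨c, hcH⟩ : H)) +
        (Fintype.card H / 2 - 1) *
          (Finset.univ.filter fun b : Block c => wt (⟨c, hcH⟩ : H) (res₁ hcH hcen x b.out) (res₀ hcH b.out) = 1).card := by
  obtain ⟨h1, h2⟩ := two_sided_spectator hcH hc2 hc1 hcen hH hx hxx hxc hm hμ
  have hβ := card_block_spectator hcH hcen hc2 hH hx hxx hxc
  obtain ⟨S, hSF, hScard, hgen⟩ := hμ.1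
  have hfl := card_block_add_le_spectator hcH hc2 hc1 hcen hH hx hxx hxc S hSF hgen
  rw [hScard] at hfl
  refine ⟨hfl, ?_⟩
  have hn : 1 ≤ Fintype.card H / 2 := by
    have hc2' := csub_mul_csub hcH hc2
    have : 0 < Fintype.card H := Fintype.card_pos
    have hdvd : 2 ∣ Fintype.card H := by
      have hord : orderOf (⟨c, hcH⟩ : H) = 2 := orderOf_eq_prime (by rw [pow_two]; exact hc2') (csub_ne_one hcH hc1)
      rw [← hord]; exact orderOf_dvd_card
    omega
  have key : (Fintype.card H / 2) *
      (Finset.univ.filter fun b : Block c => wt (⟨c, hcH⟩ : H) (res₁ hcH hcen x b.out) (res₀ hcH b.out) = 1).card =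
      (Fintype.card H / 2 - 1) *
        (Finset.univ.filter fun b : Block c => wt (⟨c, hcH⟩ : H) (res₁ hcH hcen x b.out) (res₀ hcH b.out) = 1).card +
        (Finset.univ.filter fun b : Block c => wt (⟨c, hcH⟩ : H) (res₁ hcH hcen x b.out) (res₀ hcH b.out) = 1).card := by
    rw [← Nat.sub_add_cancel hn, Nat.add_mul, one_mul, Nat.add_sub_cancel]
  omega

end

end Summit.HodgeConjecture.CorCM.Census.Spectator
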